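import Literature.MathematicalPhysics.QuantumLattice.DWaveSourceProofs
import Literature.MathematicalPhysics.QuantumLattice.LiebFluxPhaseProofs
import Literature.MathematicalPhysics.QuantumLattice.SectorSpectrum
import Literature.MathematicalPhysics.QuantumLattice.FermionOperatorsProofs
import Literature.MathematicalPhysics.QuantumLattice.HubbardWave0RepulsiveProofs

/-!
# Crux `TwSeededEnsembleEquivalence` (stmt-HubbardSuperconductivity-1698), line `exposed-density-duality` — stub `stub_pairFieldSinglet`

The bond-singlet pair field `pairField φ L = Σ_x Σ_e (φ e/√2)(c_{x↑}c_{x+e,↓} − c_{x↓}c_{x+e,↑})` commutes with `S⁺` and `S⁻` for every form factor `φ` (CAR computation: `[S⁺, c_{x↑}c_{y↓} − c_{x↓}c_{y↑}] = −c_{x↓}c_{y↓} + c_{x↓}c_{y↓} = 0`, similarly for `S⁻`).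
-/

namespace Summit.HubbardSuperconductivity.HubbardSuperconductivity.Theorems.TwSeededEnsembleEquivalence.ExposedDensity

open Matrix Filter Topology Literature.MathematicalPhysics.QuantumLattice
open scoped ComplexOrder Matrix.Norms.L2Operator

noncomputable section

section CAR

variable {ι : Type*} [LinearOrder ι] [Fintype ι]

/-- `[c†_a, c_p c_q] = δ_{pa} c_q − δ_{qa} c_p` (mixed CAR, `c_p c†_a = δ_{pa} − c†_a c_p` twice). -/
private theorem creation_commutator_annPair (a p q : ι) :
    creation a * (annihilation p * annihilation q) - annihilation p * annihilation q * creation a =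
      (if p = a then annihilation q else 0) - (if q = a then annihilation p else 0) := by
  rw [mul_assoc (annihilation p), annihilation_mul_creation q a, mul_sub, ← mul_assoc,
    ← mul_assoc, annihilation_mul_creation p a, sub_mul]
  split_ifs <;> noncomm_ring

/-- `[c†_a c_b, c_p c_q] = δ_{pa} c_q c_b − δ_{qa} c_p c_b` (`c_b` anticommutes past `c_p c_q`). -/
private theorem hop_annPair_commutator (a b p q : ι) :
    creation a * annihilation b * (annihilation p * annihilation q) -
        annihilation p * annihilation q * (creation a * annihilation b) =
      (if p = a then annihilation q * annihilation b else 0) -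
        (if q = a then annihilation p * annihilation b else 0) := by
  have hanti : ∀ i j : ι, annihilation i * annihilation j = -(annihilation j * annihilation i) :=
    fun i j => eq_neg_of_add_eq_zero_left (annihilation_anticommute_holds i j)
  have h3 : annihilation b * (annihilation p * annihilation q) =
      annihilation p * annihilation q * annihilation b := by
    rw [← mul_assoc, hanti b p, neg_mul, mul_assoc, hanti b q, mul_neg, neg_neg, mul_assoc]
  calc creation a * annihilation b * (annihilation p * annihilation q) -
        annihilation p * annihilation q * (creation a * annihilation b)
      = (creation a * (annihilation p * annihilation q) -
          annihilation p * annihilation q * creation a) * annihilation b := by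
        rw [mul_assoc (creation a), h3]; noncomm_ring
    _ = _ := by
        rw [creation_commutator_annPair, sub_mul]
        split_ifs <;> simp
end CAR

section Singlet

variable {Λ : Type*} [LinearOrder Λ] [Fintype Λ]

/-- The singlet pair annihilator `c_{Xσ} c_{Yτ} − c_{Xτ} c_{Yσ}` (`σ ≠ τ`) commutes with the
spin-flip bilinear `Σ_z c†_{zσ} c_{zτ}`: the commutator is `c_{Yτ} c_{Xτ} + c_{Xτ} c_{Yτ} = 0`. -/
private theorem singlet_commute_flipSum {σ τ : Fin 2} (hστ : σ ≠ τ) (X Y : Λ) :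
    Commute (annihilation (orb X σ) * annihilation (orb Y τ) -
        annihilation (orb X τ) * annihilation (orb Y σ))
      (∑ z : Λ, creation (orb z σ) * annihilation (orb z τ)) := by
  rw [Commute, SemiconjBy, Finset.mul_sum, Finset.sum_mul, eq_comm, ← sub_eq_zero,
    ← Finset.sum_sub_distrib]
  have key : ∀ z : Λ,
      creation (orb z σ) * annihilation (orb z τ) *
            (annihilation (orb X σ) * annihilation (orb Y τ) -
              annihilation (orb X τ) * annihilation (orb Y σ)) -
          (annihilation (orb X σ) * annihilation (orb Y τ) -
              annihilation (orb X τ) * annihilation (orb Y σ)) *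
            (creation (orb z σ) * annihilation (orb z τ)) =
        (if X = z then annihilation (orb Y τ) * annihilation (orb X τ) else 0) +
          (if Y = z then annihilation (orb X τ) * annihilation (orb Y τ) else 0) := by
    intro z
    rw [mul_sub, sub_mul, sub_sub_sub_comm, hop_annPair_commutator, hop_annPair_commutator]
    simp only [orb_eq_orb_iff, hστ.symm, and_true, and_false, if_false, sub_zero, zero_sub,
      sub_neg_eq_add]
    split_ifs with hX hY hY <;> (try subst hX) <;> (try subst hY) <;> simp
  simp_rw [key, Finset.sum_add_distrib, Finset.sum_ite_eq, Finset.mem_univ, if_true]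
  exact annihilation_anticommute_holds _ _

end Singlet

/-- The bond-singlet pair field `pairField φ L = Σ_x Σ_e (φ e/√2)(c_{x↑}c_{x+e,↓} − c_{x↓}c_{x+e,↑})` commutes with `S⁺` and `S⁻` for every form factor `φ` (CAR computation: `[S⁺, c_{x↑}c_{y↓} − c_{x↓}c_{y↑}] = −c_{x↓}c_{y↓} + c_{x↓}c_{y↓} = 0`, similarly for `S⁻`). -/
theorem stub_pairFieldSinglet :
    ∀ (φ : Literature.Probability.LatticeModels.Site 2 → ℝ) (L : ℕ) [NeZero L],
      Commute (pairField φ L) spinPlus ∧ Commute (pairField φ L) spinMinus := by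
  intro φ L _
  refine ⟨?_, ?_⟩
  · unfold pairField localPair spinPlus
    refine Commute.sum_left _ _ _ fun x _ => Commute.sum_left _ _ _ fun e _ =>
      Commute.smul_left ?_ _
    exact singlet_commute_flipSum (by decide) _ _
  · rw [spinMinus_eq_sum]
    unfold pairField localPair
    refine Commute.sum_left _ _ _ fun x _ => Commute.sum_left _ _ _ fun e _ =>
      Commute.smul_left ?_ _
    simpa only [neg_sub] using (singlet_commute_flipSum (σ := (1 : Fin 2)) (τ := 0) (by decide)
      (FermionTorus.ofTorusSite x)
      (FermionTorus.ofTorusSite (x + Literature.Probability.LatticeModels.Torus.proj L e))).neg_left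

end

end Summit.HubbardSuperconductivity.HubbardSuperconductivity.Theorems.TwSeededEnsembleEquivalence.ExposedDensity
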